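import Summits.BirchSwinnertonDyer.BirchSwinnertonDyer.Theorems.KatoDescentPotSupersingularWildUpperDefectBillSigned
import Summits.BirchSwinnertonDyer.BirchSwinnertonDyer.Theorems.KatoDescentPotSupersingularWildFineSelmerFineUnitAnchor
import HarnessLib

/-!
# Route `KatoDescentPotSupersingular` (rung K9, cell `bsd-potss`): the U₀ BILL of item
# stmt-BirchSwinnertonDyer-19197 `WildUpperDefectRankZero` with SIX anchor currencies — bill v3 (p468578)
# plus the FINE UNIT-ANCHOR currency of this seat (fine control theorem p479853; anchors of ANY reduction
# type at `3`, in particular ADDITIVE) (a `--supports … --as helper` file; seat `bsd-potss-k9-c4` g6;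
# ROUTE-FREE; nothing booked, BSD is not proved by any of this, the item is NOT closed)

WHY. After g5 the exact residue of item 19197 is ONE anchor certificate per ♯ row of the Conj-A crux 19386
(irreducible `W[3]`, 3-adic tower not onto, `3 ∣ ∏ c_ℓ` or no Manin-clean datum, non-CM) in one of five
currencies (bill v3, `WildUpperDefectBillSigned.wildUpperDefectRankZero_bill_of_fiveCurrencies`), every one
of which needs the anchor `W′` to be GOOD at `3`. The census of seat `conjA-anchor` g0 left 149 `3Nn` + 69
`3Ns` rows whose congruent CM partners are all ADDITIVE at `3` («no road»). This seat's fine control theorem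
(`FineSelmerControl.fineSelmerInfty_eq_bot_of_natCard_selmerGroupPInfty_eq_one`, Greenberg's Prop. 3.8 for
the FINE Selmer group, reduction-type-free) supplies the sixth currency, recorded here as the bill v4:
(6) a congruent `W′` — ANY reduction at `3` — with a finite set `S` of finite places off which `W′` is good
and `v ∤ 3`, `rank W′(ℚ) = 0`, `#Ш(W′)[3^∞] = 1`, and no non-zero `D_v`-fixed `3`-torsion in `W′[3^∞]` for
`v ∈ S` (`W′(ℚ_v)[3] = 0`; `WildFineSelmerFineUnitAnchor.conjA_rat_of_fineUnitData`). It is mapped into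
currency (1) and bill v3 is applied verbatim — `wildUpperDefectRankZero_bill_of_sixCurrencies`. Against the
route decls the conclusion is the BODY of `WildUpperDefectRankZero` (the file does not import the route, so
that `closes` may use it); `h₂`/`hR` are the bodies of L₀ (`WildLowerHalfRankZero`) and R₁ (`WildRankOne`).

HONEST FRAMING: conditional-result on the displayed named facts (all published theorems typed in the
tree; no new fact; currency (6) itself uses none of `hPRS h12 hKim hPR`); the per-row data are hypotheses
(census data of record, not kernel inputs); item 19197 is NOT closed (derived support; it closes only with
19189/19190/19191); class-wide the open content is Coates–Sujatha (A) on the ♯ rows (crux 19386, a named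
open problem). References: [Kato2004Asterisque] Thm. 14.5 (3), Prop. 14.16 (2); [LimSujatha2018] §3 Prop.
3.2; [GreenbergLNM1716] Prop. 3.8, §4 Thm. 4.1; [Kobayashi2003] Thm. 1.2; [BDKim2013] Cor. 3.15;
[PollackRubin2004] Theorem (p. 448); [MatarNekovar2019] Thm. 0.3; [CoatesSujatha2005] §3.
-/

set_option autoImplicit false
-- sibling precedent (`KatoDescentPotSupersingularAssembly.lean`): the directory name repeats the summit name
set_option linter.dupNamespace false

noncomputable section

open scoped Classical MatrixGroups ModularForm

namespace Summit.BirchSwinnertonDyer.BirchSwinnertonDyer.Theorems.WildUpperDefectBillFine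

open NumberField IsDedekindDomain
open CongruenceSubgroup WeierstrassCurve Literature.NumberTheory.EllipticCurves
  Literature.NumberTheory.EllipticCurves.ModularForms
  Literature.NumberTheory.EllipticCurves.GreenbergSelmer
  Literature.NumberTheory.EllipticCurves.Rank1Residual
  Literature.NumberTheory.EllipticCurves.Rank1Residual.Typed
  Literature.NumberTheory.EllipticCurves.Kobayashi2003
  Summit.BirchSwinnertonDyer.Rank1Residual Summit.BirchSwinnertonDyer.Rank1Residual.Additive
  Summit.BirchSwinnertonDyer.Rank1Residual.O6
  Summit.BirchSwinnertonDyer.BirchSwinnertonDyer.Theorems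

/-- **THE U₀ BILL v4 (item 19197): six anchor currencies.** As bill v3 (`hGZ … hin`, `h12 hKim hPR`, `h₂`,
`hR`); per irreducible tower-deficient ♯ non-CM row ONE globally minimal `W′` with `W′[3] ≃ W[3]` and ONE of:
(1) (A) at `(W′,3)` for every cyclotomic datum; (2) finite `Sel_{3^∞}(W′/ℚ^cyc)[3]` for every cyclotomic
datum; (3) Greenberg unit data (good ordinary at `3`, `rank = 0`, `#Ш[3^∞] = 1`, `3 ∤ #tors·Tam·#Ẽ′(𝔽₃)`);
(4) SUPERSINGULAR unit data (good at `3`, `a₃ = 0`, `rank = 0`, `#Ш[3^∞] = 1`, `3 ∤ Tam`);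
(5) CM good supersingular at `3` with a newform, `ϖ·Ω = Ω⁺_f`, a Pollack pair at `3`, a sign `ε` and a
`3`-adic unit coefficient of `ϖ·L^{∓}`; (6) FINE unit data — ANY reduction at `3`: a finite set `S` of places off
which `W′` is good and `v ∤ 3`, `rank = 0`, `#Ш[3^∞] = 1`, and no non-zero `D_v`-fixed `3`-torsion in `W′[3^∞]`
for `v ∈ S` (`W′(ℚ_v)[3] = 0`; fine control theorem p479853). Conclusion: the BODY of `WildUpperDefectRankZero`.
Conditional; the item is NOT closed. [cite: GreenbergLNM1716, Prop. 3.8 (pp. 95–96)] [cite: CoatesSujatha2005, §3 (Conjecture A)] [cite: Kato2004Asterisque, Thm. 14.5 (3) (p. 236), Prop. 14.16 (2) (p. 244)]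
[cite: Kobayashi2003, Thm. 1.2] [cite: BDKim2013, Cor. 3.15 (p. 199)] [cite: PollackRubin2004, Theorem (p. 448)]
[cite: LimSujatha2018, §3 Prop. 3.2] [cite: GreenbergLNM1716, §4 Thm. 4.1 (p. 85)] -/
theorem wildUpperDefectRankZero_bill_of_sixCurrencies
    (hGZ : ∀ (N : ℕ) [NeZero N] (W : WeierstrassCurve ℚ) (K : Type) [Field K] [NumberField K],
      gross_zagier N W K)
    (hKo : ∀ (N : ℕ) [NeZero N] (W : WeierstrassCurve ℚ) (K : Type) [Field K] [NumberField K],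
      kolyvagin N W K)
    (hMN : ∀ (N : ℕ) [NeZero N] (W : WeierstrassCurve ℚ) (K : Type) [Field K] [NumberField K],
      MatarNekovar2019.thm03_padicValNat_card_sha_le_of_irreducible N W K)
    (hnf : exists_isNewformOf) (hBFH : bumpFriedbergHoffstein_exists_heegnerField_split_twist_simpleZero)
    (hK : Kato2004.rankZero_padicValNat_sha_add_padicValNat_tamagawa_le_of_additive_potGood_of_imageContainsSL2 ∧
      rank_eq_analyticRank_of_analyticRank_le_one ∧ WeierstrassCurve.hasEntireLFunction_rat)
    (hF : Kato2004.rankZero_padicValNat_sha_add_padicValNat_tamagawa_le_of_additive_potGood_of_irreducible_of_fineSelmerDual_fg ∧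
      bsdTriple_of_hasCM_of_L_one_ne_zero)
    (hCassels : bsdRHS_eq_of_isIsogenous)
    (hLS : LimSujatha2018.prop32_fineSelmerDual_moduleFinite_iff_of_torsionIso)
    (hPRS : Schneider1985_order_charGenerator_odd)
    (h12 : Kobayashi2003.thm12_signedSelmerDual_finite_torsion)
    (hKim : BDKim2013.cor315_signedCharValue_rankZero)
    (hPR : PollackRubin2004.mainTheorem_signedCharIdeal_eq_of_cm)
    (hne : Kato2004.nonempty_iwasawaH1Data) (hin : Kato2004.exists_memberHullCountInputs)
    (h₂ : ∀ (W : WeierstrassCurve ℚ) [W.IsElliptic] [W.IsGloballyMinimal] [Fact (3 : ℕ).Prime],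
      W.analyticRank = 0 → ClassO6 W 3 → MissingLowerBoundAt W 3)
    (hR : ∀ (W : WeierstrassCurve ℚ) [W.IsElliptic] [W.IsGloballyMinimal] [Fact (3 : ℕ).Prime],
      W.analyticRank = 1 → ClassO6 W 3 → MissingPPartAt W 3)
    (hcert : ∀ (W : WeierstrassCurve ℚ) [W.IsElliptic] [W.IsGloballyMinimal] [Fact (3 : ℕ).Prime],
      W.analyticRank = 0 → ClassO6 W 3 → W.HasIrreducibleModPGaloisRep 3 →
      ¬ (∀ n : ℕ, W.HasSurjectiveModNGaloisRep (3 ^ n : ℕ)) →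
      (3 ∣ W.tamagawaProduct ∨ ∀ [NeZero (W.conductorNorm ℤ)]
        (D : ModularParametrizationData W (W.conductorNorm ℤ)), (3 : ℤ) ∣ D.maninConstant) →
      ¬ W.HasCM →
      ∃ (W' : WeierstrassCurve ℚ) (_ : W'.IsElliptic) (_ : W'.IsGloballyMinimal), ModPCongruent W' W 3 ∧
        ((∀ (κ : ZpExtension ℚ 3), κ.IsCyclotomic →
            ∃ (γ : Field.absoluteGaloisGroup ℚ) (D : W'.FineSelmerDualData κ γ),
              Module.Finite ℤ_[3] (RestrictScalars ℤ_[3] (IwasawaAlgebra 3) D.X)) ∨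
          (∀ (κ : ZpExtension ℚ 3), κ.IsCyclotomic → Set.Finite {s : W'.selmerInfty κ | 3 • s = 0}) ∨
          (W'.HasGoodReductionAtPrime 3 ∧ ¬ (3 : ℤ) ∣ W'.frobeniusTrace 3 ∧ W'.mordellWeilRank = 0 ∧
            Nat.card (AddCommGroup.primaryComponent W'.sha 3) = 1 ∧ ¬ 3 ∣ W'.torsionOrder ∧
            ¬ 3 ∣ W'.tamagawaProduct ∧ ¬ 3 ∣ W'.reductionPointCount 3) ∨
          (W'.HasGoodReductionAtPrime 3 ∧ W'.frobeniusTrace 3 = 0 ∧ W'.mordellWeilRank = 0 ∧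
            Nat.card (AddCommGroup.primaryComponent W'.sha 3) = 1 ∧ ¬ 3 ∣ W'.tamagawaProduct) ∨
          (W'.HasCM ∧ GoodSS W' 3 ∧ ∃ (ε : ℤˣ) (_ : NeZero (W'.conductorNorm ℤ))
              (f : CuspForm (Gamma0 (W'.conductorNorm ℤ)) 2) (ϖ : ℚ) (Lplus Lminus : IwasawaAlgebra 3),
            IsNewformOf W' f ∧ (ϖ : ℝ) * W'.realPeriodRat = plusPeriod f ∧
            Supersingular.IsPollackPair f 3 Lplus Lminus ∧
            ∃ k : ℕ, ‖(ϖ : ℚ_[3]) *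
              PowerSeries.coeff k (iwasawaToPowerSeries 3 (if ε = 1 then Lminus else Lplus))‖ = 1) ∨
          (∃ S : Finset (HeightOneSpectrum (𝓞 ℚ)),
            (∀ v ∉ S, ((3 : ℕ) : 𝓞 ℚ) ∉ v.asIdeal ∧ W'.HasGoodReductionAt v) ∧
            W'.mordellWeilRank = 0 ∧ Nat.card (AddCommGroup.primaryComponent W'.sha 3) = 1 ∧
            ∀ v ∈ S, ∀ x : W'.geomPrimaryTorsion 3, 3 • x = 0 → (∀ d ∈ decomp v, d • x = x) → x = 0))) :
    ∀ (W : WeierstrassCurve ℚ) [W.IsElliptic] [W.IsGloballyMinimal] [Fact (3 : ℕ).Prime],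
      W.analyticRank = 0 → ClassO6 W 3 →
      ¬ (((∀ n : ℕ, W.HasSurjectiveModNGaloisRep (3 ^ n : ℕ)) ∧ ¬ 3 ∣ W.tamagawaProduct ∧
            ∃ (N : ℕ) (_ : NeZero N) (D : ModularParametrizationData W N), ¬ (3 : ℤ) ∣ D.maninConstant) ∨
        (¬ W.HasIrreducibleModPGaloisRep 3 ∧
          (∀ (W' : WeierstrassCurve ℚ) [W'.IsElliptic], IsIsogenous W W' → ¬ 3 ^ 2 ∣ W'.torsionOrder) ∧
          ∀ q : ℚ, shaAn W = (q : ℂ) → Even (padicValRat 3 q))) →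
      MissingUpperBoundAt W 3 := by
  refine WildUpperDefectBillSigned.wildUpperDefectRankZero_bill_of_fiveCurrencies hGZ hKo hMN hnf hBFH hK hF
    hCassels hLS hPRS h12 hKim hPR hne hin h₂ hR fun W _ _ _ hr hO hirr hns hsharp hcm ↦ ?_
  obtain ⟨W', hW', hW'min, hcong, h1 | h2 | h3 | h4 | h5 | h6⟩ := hcert W hr hO hirr hns hsharp hcm
  · exact ⟨W', hW', hW'min, hcong, Or.inl h1⟩
  · exact ⟨W', hW', hW'min, hcong, Or.inr (Or.inl h2)⟩
  · exact ⟨W', hW', hW'min, hcong, Or.inr (Or.inr (Or.inl h3))⟩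
  · exact ⟨W', hW', hW'min, hcong, Or.inr (Or.inr (Or.inr (Or.inl h4)))⟩
  · exact ⟨W', hW', hW'min, hcong, Or.inr (Or.inr (Or.inr (Or.inr h5)))⟩
  · -- (6) fine unit data ⟹ (A) at `(W′,3)` (fine control theorem; no reduction hypothesis at `3`)
    haveI := hW'
    obtain ⟨S, hS, hrank', hsha', hloc'⟩ := h6
    exact ⟨W', hW', hW'min, hcong, Or.inl
      (WildFineSelmerFineUnitAnchor.conjA_rat_of_fineUnitData W' S hS hrank' hsha' hloc')⟩

end Summit.BirchSwinnertonDyer.BirchSwinnertonDyer.Theorems.WildUpperDefectBillFine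

end
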